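import Mathlib.Data.Real.Basic
import Mathlib.Data.Finset.Max
import Mathlib.Logic.Function.Iterate
import HarnessLib

/-!
# The cyclic successor of a finite set of reals-keyed elements, and its first return to a subset
# (generic brick for (G2)/(G3) of `phase2/LEAN-FACES-DESIGN.md` §5.5)

HONEST FRAMING. Part of the venture `Summits/Ventures/Crystal3D` (cell `pub-crystal3d`, phase 2;
seat typer-bulk-2), PURELY COMBINATORIAL and generic (folklore). For a finite set `A` and a key
`θ : β → ℝ` injective on `A`, `cycSucc A θ a` is the element of `A` whose key is the least key
above `θ a`, or the element with the least key of all if no key is above `θ a` — the successor of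
`a` in the CYCLIC order of `A` by `θ` (both the cell's vertex rotation `nextNbr`/`onextNbr` of the
tight graph, keyed by azimuths, and the azimuth enumeration `NbrEnum` of the fan neighbours in the
tree's hull triangulation are instances). Proved here:

* the order-theoretic characterisations `eq_cycSucc_of_above` / `eq_cycSucc_of_wrap`,
  `cycSucc_mem`, `cycSucc_injOn`;
* `reach`: iterating `cycSucc A θ` from `x` climbs through the keys and reaches any `b' ∈ A` with
  `θ x ≤ θ b'`, all intermediate keys lying in `[θ x, θ b')`; hence `exists_iterate_eq`
  (**`A` is a single cycle**);
* **`firstReturn`**: for `B ⊆ A` and `b ∈ B`, the first return to `B` of the `cycSucc A θ`-orbit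
  of `b` is `cycSucc B θ b` — the cyclic order of a subset is the induced one. This is the
  combinatorial heart of the wiring (G3): the rotation of the tight graph at a vertex is the
  first-return map of the rotation of the ambient hull triangulation.
-/

namespace Summit.Ventures.Crystal3D

namespace CycOrd

variable {β : Type*}

/-! ## An element of least key -/

/-- An element of the nonempty finset `s` minimising the key `θ`. -/
noncomputable def minKey (s : Finset β) (θ : β → ℝ) (h : s.Nonempty) : β :=
  Classical.choose (s.exists_min_image θ h)

/-- `minKey` lies in the set. -/
theorem minKey_mem (s : Finset β) (θ : β → ℝ) (h : s.Nonempty) : minKey s θ h ∈ s :=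
  (Classical.choose_spec (s.exists_min_image θ h)).1

/-- `minKey` minimises the key. -/
theorem minKey_le (s : Finset β) (θ : β → ℝ) (h : s.Nonempty) {x : β} (hx : x ∈ s) :
    θ (minKey s θ h) ≤ θ x :=
  (Classical.choose_spec (s.exists_min_image θ h)).2 x hx

/-! ## The cyclic successor -/

/-- The elements of `A` whose key is above `θ a`. -/
noncomputable def above (A : Finset β) (θ : β → ℝ) (a : β) : Finset β :=
  A.filter fun b => θ a < θ b

/-- Membership in `above`. -/
theorem mem_above {A : Finset β} {θ : β → ℝ} {a b : β} :
    b ∈ above A θ a ↔ b ∈ A ∧ θ a < θ b :=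
  Finset.mem_filter

/-- **The cyclic successor** of `a` in `A` for the key `θ`: the element of `A` with the least key
above `θ a`; if there is none, the element of `A` with the least key; junk `a` if `A = ∅`. -/
noncomputable def cycSucc (A : Finset β) (θ : β → ℝ) (a : β) : β :=
  if h : (above A θ a).Nonempty then minKey (above A θ a) θ h
  else if h' : A.Nonempty then minKey A θ h' else a

variable {A B : Finset β} {θ : β → ℝ} {a b x : β}

/-- The successor lies in `A`. -/
theorem cycSucc_mem (hA : A.Nonempty) (a : β) : cycSucc A θ a ∈ A := by
  unfold cycSucc
  split_ifs with h
  · exact (mem_above.1 (minKey_mem _ θ h)).1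
  · exact minKey_mem A θ hA

/-- Iterates stay in `A`. -/
theorem iterate_cycSucc_mem (ha : a ∈ A) (n : ℕ) : (cycSucc A θ)^[n] a ∈ A := by
  induction n with
  | zero => exact ha
  | succ n ih => rw [Function.iterate_succ_apply']; exact cycSucc_mem ⟨a, ha⟩ _

/-- If some key is above `θ a`, the successor's key is above `θ a` … -/
theorem lt_cycSucc (h : ∃ b ∈ A, θ a < θ b) : θ a < θ (cycSucc A θ a) := by
  obtain ⟨b, hb, hab⟩ := h
  have hne : (above A θ a).Nonempty := ⟨b, mem_above.2 ⟨hb, hab⟩⟩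
  unfold cycSucc
  rw [dif_pos hne]
  exact (mem_above.1 (minKey_mem _ θ hne)).2

/-- … and at most any key above `θ a`. -/
theorem cycSucc_le (hb : b ∈ A) (hab : θ a < θ b) : θ (cycSucc A θ a) ≤ θ b := by
  have hne : (above A θ a).Nonempty := ⟨b, mem_above.2 ⟨hb, hab⟩⟩
  unfold cycSucc
  rw [dif_pos hne]
  exact minKey_le _ θ hne (mem_above.2 ⟨hb, hab⟩)

/-- If no key is above `θ a`, the successor has the least key of all. -/
theorem cycSucc_le_of_wrap (h : ∀ b ∈ A, θ b ≤ θ a) (hb : b ∈ A) : θ (cycSucc A θ a) ≤ θ b := by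
  have hne : ¬ (above A θ a).Nonempty := by
    rintro ⟨x, hx⟩
    obtain ⟨hxA, hax⟩ := mem_above.1 hx
    exact absurd (h x hxA) (not_le.2 hax)
  unfold cycSucc
  rw [dif_neg hne, dif_pos ⟨b, hb⟩]
  exact minKey_le A θ _ hb

/-- **Characterisation, climbing case**: the element of `A` with the least key above `θ a` IS the
successor (keys injective on `A`). -/
theorem eq_cycSucc_of_above (hθ : Set.InjOn θ A) (hb : b ∈ A) (hab : θ a < θ b)
    (hmin : ∀ x ∈ A, θ a < θ x → θ b ≤ θ x) : cycSucc A θ a = b := by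
  have hsA : cycSucc A θ a ∈ A := cycSucc_mem ⟨b, hb⟩ a
  refine hθ hsA hb (le_antisymm (cycSucc_le hb hab) ?_)
  exact hmin _ hsA (lt_cycSucc ⟨b, hb, hab⟩)

/-- **Characterisation, wrap-around case**: if no key is above `θ a`, the element of least key
IS the successor. -/
theorem eq_cycSucc_of_wrap (hθ : Set.InjOn θ A) (hb : b ∈ A) (hmax : ∀ x ∈ A, θ x ≤ θ a)
    (hmin : ∀ x ∈ A, θ b ≤ θ x) : cycSucc A θ a = b := by
  have hsA : cycSucc A θ a ∈ A := cycSucc_mem ⟨b, hb⟩ a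
  exact hθ hsA hb (le_antisymm (cycSucc_le_of_wrap hmax hb) (hmin _ hsA))

/-- The successor map is injective on `A` (keys injective on `A`). -/
theorem cycSucc_injOn (hθ : Set.InjOn θ A) : Set.InjOn (cycSucc A θ) (A : Set β) := by
  intro a₁ h₁ a₂ h₂ heq
  rw [Finset.mem_coe] at h₁ h₂
  by_contra hne
  have hkey : θ a₁ ≠ θ a₂ := fun h => hne (hθ h₁ h₂ h)
  rcases lt_or_gt_of_ne hkey with hlt | hlt
  · have h1 : θ (cycSucc A θ a₁) ≤ θ a₂ := cycSucc_le h₂ hlt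
    have h1' : θ a₁ < θ (cycSucc A θ a₁) := lt_cycSucc ⟨a₂, h₂, hlt⟩
    by_cases hab : ∃ b ∈ A, θ a₂ < θ b
    · have h2 : θ a₂ < θ (cycSucc A θ a₂) := lt_cycSucc hab
      rw [heq] at h1; exact absurd h1 (not_le.2 h2)
    · push Not at hab
      have h2 : θ (cycSucc A θ a₂) ≤ θ a₁ := cycSucc_le_of_wrap hab h₁
      rw [heq] at h1'; exact absurd h2 (not_le.2 h1')
  · have h1 : θ (cycSucc A θ a₂) ≤ θ a₁ := cycSucc_le h₁ hlt
    have h1' : θ a₂ < θ (cycSucc A θ a₂) := lt_cycSucc ⟨a₁, h₁, hlt⟩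
    by_cases hab : ∃ b ∈ A, θ a₁ < θ b
    · have h2 : θ a₁ < θ (cycSucc A θ a₁) := lt_cycSucc hab
      rw [← heq] at h1; exact absurd h1 (not_le.2 h2)
    · push Not at hab
      have h2 : θ (cycSucc A θ a₁) ≤ θ a₂ := cycSucc_le_of_wrap hab h₂
      rw [← heq] at h1'; exact absurd h2 (not_le.2 h1')

/-! ## Climbing: the orbit reaches every larger key -/

/-- **Climbing lemma.** From `x ∈ A`, iterating the successor reaches any `b' ∈ A` with
`θ x ≤ θ b'`, and all the intermediate keys lie in `[θ x, θ b')` (induction on the number of keys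
above `θ x`). -/
theorem reach_aux (hθ : Set.InjOn θ A) {b' : β} (hb' : b' ∈ A) :
    ∀ n : ℕ, ∀ x ∈ A, (above A θ x).card ≤ n → θ x ≤ θ b' →
      ∃ t, (cycSucc A θ)^[t] x = b' ∧
        ∀ s < t, θ x ≤ θ ((cycSucc A θ)^[s] x) ∧ θ ((cycSucc A θ)^[s] x) < θ b' := by
  intro n
  induction n with
  | zero =>
    intro x hx hcard hle
    have hempty : above A θ x = ∅ := Finset.card_eq_zero.1 (Nat.le_zero.1 hcard)
    have hnlt : ¬ θ x < θ b' := fun hlt => by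
      have hmem : b' ∈ above A θ x := mem_above.2 ⟨hb', hlt⟩
      rw [hempty] at hmem
      simp at hmem
    have heq : x = b' := hθ hx hb' (le_antisymm hle (not_lt.1 hnlt))
    exact ⟨0, by simp [heq], fun s hs => absurd hs (Nat.not_lt_zero _)⟩
  | succ n ih =>
    intro x hx hcard hle
    rcases eq_or_lt_of_le hle with heq | hlt
    · have hxb : x = b' := hθ hx hb' heq
      exact ⟨0, by simp [hxb], fun s hs => absurd hs (Nat.not_lt_zero _)⟩
    · have hx'A : cycSucc A θ x ∈ A := cycSucc_mem ⟨x, hx⟩ x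
      have hxx' : θ x < θ (cycSucc A θ x) := lt_cycSucc ⟨b', hb', hlt⟩
      have hx'b : θ (cycSucc A θ x) ≤ θ b' := cycSucc_le hb' hlt
      have hcard' : (above A θ (cycSucc A θ x)).card ≤ n := by
        have hss : above A θ (cycSucc A θ x) ⊂ above A θ x := by
          rw [Finset.ssubset_iff_of_subset]
          · exact ⟨cycSucc A θ x, mem_above.2 ⟨hx'A, hxx'⟩,
              fun h => lt_irrefl _ (mem_above.1 h).2⟩
          · intro y hy
            obtain ⟨hyA, hy'⟩ := mem_above.1 hy
            exact mem_above.2 ⟨hyA, hxx'.trans hy'⟩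
        have := Finset.card_lt_card hss
        omega
      obtain ⟨t, ht, hs⟩ := ih _ hx'A hcard' hx'b
      refine ⟨t + 1, by rw [Function.iterate_succ_apply]; exact ht, ?_⟩
      intro s hs'
      rcases s with _ | s
      · exact ⟨le_rfl, by simpa using hlt⟩
      · rw [Function.iterate_succ_apply]
        obtain ⟨h1, h2⟩ := hs s (by omega)
        exact ⟨(hxx'.trans_le h1).le, h2⟩

/-- **Climbing lemma** (packaged). -/
theorem reach (hθ : Set.InjOn θ A) (hx : x ∈ A) {b' : β} (hb' : b' ∈ A) (hle : θ x ≤ θ b') :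
    ∃ t, (cycSucc A θ)^[t] x = b' ∧
      ∀ s < t, θ x ≤ θ ((cycSucc A θ)^[s] x) ∧ θ ((cycSucc A θ)^[s] x) < θ b' :=
  reach_aux hθ hb' _ x hx le_rfl hle

/-- **`A` is a single cycle of `cycSucc A θ`**: every element is an iterate of every other
(climb to the maximum, wrap to the minimum, climb to the target). -/
theorem exists_iterate_eq (hθ : Set.InjOn θ A) (ha : a ∈ A) (hb : b ∈ A) :
    ∃ n, (cycSucc A θ)^[n] a = b := by
  obtain ⟨M, hM, hMmax⟩ := A.exists_max_image θ ⟨a, ha⟩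
  obtain ⟨m, hm, hmmin⟩ := A.exists_min_image θ ⟨a, ha⟩
  obtain ⟨t₁, ht₁, -⟩ := reach hθ ha hM (hMmax a ha)
  have hwrap : cycSucc A θ M = m := eq_cycSucc_of_wrap hθ hm hMmax hmmin
  obtain ⟨t₂, ht₂, -⟩ := reach hθ hm hb (hmmin b hb)
  refine ⟨t₂ + (1 + t₁), ?_⟩
  rw [Function.iterate_add_apply, Function.iterate_add_apply, ht₁, Function.iterate_one, hwrap, ht₂]

/-! ## First return to a subset -/

/-- **First-return lemma.** For `B ⊆ A` (keys injective on `A`) and `b ∈ B`, the orbit of `b`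
under `cycSucc A θ` returns to `B` for the first time exactly at `cycSucc B θ b`: the cyclic
order of `B` by `θ` is the one induced from the cyclic order of `A`. -/
theorem firstReturn (hθ : Set.InjOn θ A) (hBA : B ⊆ A) (hb : b ∈ B) :
    ∃ t, 0 < t ∧ (cycSucc A θ)^[t] b = cycSucc B θ b ∧
      ∀ s, 0 < s → s < t → (cycSucc A θ)^[s] b ∉ B := by
  have hbA : b ∈ A := hBA hb
  have hb'B : cycSucc B θ b ∈ B := cycSucc_mem ⟨b, hb⟩ b
  have hb'A : cycSucc B θ b ∈ A := hBA hb'B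
  by_cases hcase : ∃ x ∈ B, θ b < θ x
  · -- climbing case: `cycSucc B θ b` is the least key of `B` above `θ b`
    have hbb' : θ b < θ (cycSucc B θ b) := lt_cycSucc hcase
    have hmin : ∀ x ∈ B, θ b < θ x → θ (cycSucc B θ b) ≤ θ x := fun x hx hlt => cycSucc_le hx hlt
    have h1 : θ b < θ (cycSucc A θ b) := lt_cycSucc ⟨_, hb'A, hbb'⟩
    have h1' : θ (cycSucc A θ b) ≤ θ (cycSucc B θ b) := cycSucc_le hb'A hbb'
    obtain ⟨t, ht, hs⟩ := reach hθ (cycSucc_mem ⟨b, hbA⟩ b) hb'A h1'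
    refine ⟨t + 1, Nat.succ_pos _, by rw [Function.iterate_succ_apply]; exact ht, ?_⟩
    intro s hs0 hst hmem
    obtain ⟨s', rfl⟩ : ∃ s', s = s' + 1 := ⟨s - 1, by omega⟩
    rw [Function.iterate_succ_apply] at hmem
    obtain ⟨hlo, hhi⟩ := hs s' (by omega)
    exact absurd (hmin _ hmem (h1.trans_le hlo)) (not_le.2 hhi)
  · -- wrap-around case: nothing of `B` is above `θ b`; `cycSucc B θ b` is the least key of `B`
    push Not at hcase
    have hmin : ∀ x ∈ B, θ (cycSucc B θ b) ≤ θ x := fun x hx => cycSucc_le_of_wrap hcase hx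
    obtain ⟨M, hM, hMmax⟩ := A.exists_max_image θ ⟨b, hbA⟩
    obtain ⟨m, hm, hmmin⟩ := A.exists_min_image θ ⟨b, hbA⟩
    have hwrap : cycSucc A θ M = m := eq_cycSucc_of_wrap hθ hm hMmax hmmin
    -- phase 1: from `b` to the maximum `M` of `A`, avoiding `B` after time `0`
    have phase1 : ∃ t₁, (cycSucc A θ)^[t₁] b = M ∧
        ∀ s, 0 < s → s ≤ t₁ → (cycSucc A θ)^[s] b ∉ B := by
      by_cases hbM : b = M
      · exact ⟨0, by simp [hbM], fun s hs0 hs => absurd hs (by omega)⟩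
      · have hlt : θ b < θ M := lt_of_le_of_ne (hMmax b hbA) fun h => hbM (hθ hbA hM h)
        have h1 : θ b < θ (cycSucc A θ b) := lt_cycSucc ⟨M, hM, hlt⟩
        have h1' : θ (cycSucc A θ b) ≤ θ M := cycSucc_le hM hlt
        obtain ⟨t, ht, hs⟩ := reach hθ (cycSucc_mem ⟨b, hbA⟩ b) hM h1'
        refine ⟨t + 1, by rw [Function.iterate_succ_apply]; exact ht, ?_⟩
        intro s hs0 hst hmem
        obtain ⟨s', rfl⟩ : ∃ s', s = s' + 1 := ⟨s - 1, by omega⟩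
        rw [Function.iterate_succ_apply] at hmem
        have hkey : θ b < θ ((cycSucc A θ)^[s'] (cycSucc A θ b)) := by
          rcases Nat.lt_or_ge s' t with hlt' | hge
          · exact h1.trans_le (hs s' hlt').1
          · have hs't : s' = t := by omega
            rw [hs't, ht]; exact hlt
        exact absurd (hcase _ hmem) (not_le.2 hkey)
    obtain ⟨t₁, ht₁, hs₁⟩ := phase1
    -- phase 2: from the minimum `m` of `A` to `cycSucc B θ b`
    obtain ⟨t₂, ht₂, hs₂⟩ := reach hθ hm hb'A (hmmin _ hb'A)
    refine ⟨t₂ + (1 + t₁), by omega, ?_, ?_⟩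
    · rw [Function.iterate_add_apply, Function.iterate_add_apply, ht₁, Function.iterate_one, hwrap,
        ht₂]
    · intro s hs0 hst hmem
      rcases Nat.lt_or_ge t₁ s with hgt | hle
      · obtain ⟨s₂, rfl⟩ : ∃ s₂, s = s₂ + (1 + t₁) := ⟨s - (1 + t₁), by omega⟩
        rw [Function.iterate_add_apply, Function.iterate_add_apply, ht₁, Function.iterate_one,
          hwrap] at hmem
        have hhi := (hs₂ s₂ (by omega)).2
        exact absurd (hmin _ hmem) (not_le.2 hhi)
      · exact hs₁ s hs0 hle hmem

end CycOrd

end Summit.Ventures.Crystal3D
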